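import Mathlib
import HarnessLib
import Literature.MathematicalPhysics.QuantumFieldTheory.WilsonPlaquettePositivity
import Summits.Ventures.LatticeQCDFlow.Scaling.AutoregressiveGaugePlaquetteReads

/-!
# LatticeQCDFlow / Scaling — EVERY compact gauge group, EVERY dimension: the partial Haar marginal
# over the links off a plaquette READS the closing link (the engine of the gauge-case lower bounds)

HONEST FRAMING: exact (Metropolis-corrected) sampling algorithms for lattice gauge theory;
figures of merit are autocorrelation/cost numbers at stated couplings and volumes; no
continuum-physics claim.

Venture `LatticeQCDFlow` (cell pub-lqcd), topic `Scaling`, FANOUT row 30 (lean-1, GEN-18) — OUR WORK on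
THEORY-2.md §4 row C5, gauge case: the lower bound on the exact autoregressive context of a gauge link,
so far typed for `U(1)` in two dimensions (GEN-17 `Scaling/AutoregressiveGaugePlaquetteReads`, explicit
convolution powers), now for EVERY compact gauge group `G` and continuous `N`-dimensional representation
`ρ` with a CENTRAL element acting by a scalar `ω ≠ 1`, `|ω| = 1` (the centre of `SU(N)` in the
fundamental, `−1 ∈ U(1)`), in EVERY dimension `d`, every volume `L ≥ 2`, at every `β > 0`.  Plaquette
`p = (x; k, l)`, `k < l`; `e₁ = (x, k)` its first ("closing") link; `s` = all links off `p` (integrated);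
`F = e^{−βS_W}`, `N = A_s F` (`Exactness.coordAvg`).

* §1 `wilsonWeight_props` (measurable, squeezed between two positive constants),
  `integral_comp_plaquetteHolonomy_mul` (redrawing `e₁` makes `hol_p` Haar against any bounded factor
  blind to `e₁`), `single_add_single_ne_zero_of_ne`.
* §2 **`wilson_plaquetteMarginal_reads_closingLink`** — `N` is NOT blind to `e₁`: `N(U[e₁ ↦ v]) ≠ N(U)`
  for some `U, v`.  Otherwise `A_s F` = conditional expectation (`integral_mul_coordAvg_eq`) and the
  redraw give `∫ Re tr ρ(U_p) e^{−βS_W} = (∫ Re tr ρ(U_p) dHaar^{⊗E})·(∫ N) = 0` (the Haar mean of the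
  plaquette character vanishes, tree `WilsonPlaquettePositivity.integral_re_trace_plaquetteHolonomy_eq_zero`),
  contradicting THE STRICTLY POSITIVE PLAQUETTE MEAN `⟨Re tr ρ(U_p)⟩_β > 0` (tree
  `WilsonPlaquettePositivity.wilsonExpectation_re_trace_plaquette_pos`: strict energy monotonicity);
  `wilson_u1_plaquetteMarginal_reads_closingLink'` — the `U(1)` instance (`z = −1`).

READING (value-free, C5): for Wilson lattice gauge theory with any such gauge group in any dimension —
`SU(3)` in four dimensions included — the exact autoregressive conditional of the link closing a
plaquette is a genuine function of that link; the sequel `Scaling/AutoregressiveGaugePlaquetteReadsAnyGroup`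
walks the corners (`Scaling/AutoregressiveGaugeCornerMoves`) to show it reads EACH staple link.  NOT
CLAIMED: representations without such a central element; any rate in `β`; any number of ours.
Elementary over the parents; no `def`; nothing is cited as a fact beyond the tree; no `sorry`.
-/

noncomputable section

namespace Summit.Ventures.LatticeQCDFlow.Theory2.Autoregressive

open MeasureTheory Function Set
open Literature.MathematicalPhysics.QuantumFieldTheory Literature.MathematicalPhysics.QuantumLattice
open Summit.Ventures.LatticeQCDFlow.Exactness

variable {d L N : ℕ} {G : Type*} [Group G] [TopologicalSpace G] [IsTopologicalGroup G]
  [CompactSpace G] [SecondCountableTopology G] [MeasurableSpace G] [BorelSpace G] [NeZero L]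
  (ρ : G →* Matrix (Fin N) (Fin N) ℂ)

/-! ## §1 Bookkeeping -/

/-- The Wilson weight `e^{−βS_W}` is measurable and squeezed between two positive constants
(continuous `ρ`, finite torus). [ours] -/
theorem wilsonWeight_props (hρ : Continuous ρ) (β : ℝ) :
    Measurable (fun U : GaugeConfig d L G => Real.exp (-β * wilsonAction ρ U)) ∧
      ∃ B : ℝ, (∀ U : GaugeConfig d L G, Real.exp (-(|β| * B)) ≤ Real.exp (-β * wilsonAction ρ U)) ∧
        ∀ U : GaugeConfig d L G, Real.exp (-β * wilsonAction ρ U) ≤ Real.exp (|β| * B) := by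
  obtain ⟨B, hB⟩ := exists_abs_wilsonAction_le (d := d) (L := L) ρ hρ
  have hb : ∀ U : GaugeConfig d L G, |-β * wilsonAction ρ U| ≤ |β| * B := fun U => by
    rw [abs_mul, abs_neg]; exact mul_le_mul_of_nonneg_left (hB U) (abs_nonneg _)
  refine ⟨Real.measurable_exp.comp ((measurable_wilsonAction ρ hρ).const_mul _), B, fun U => ?_,
    fun U => ?_⟩
  · exact Real.exp_le_exp.2 (abs_le.1 (hb U)).1
  · exact Real.exp_le_exp.2 (abs_le.1 (hb U)).2

omit [SecondCountableTopology G] in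
/-- **Redrawing the first link makes the plaquette holonomy Haar, independently of any factor blind
to that link**: `∫ H(hol_{(x;i,j)} U)·Nf(U) dHaar^{⊗E}(U) = (∫ H dHaar)·∫ Nf dHaar^{⊗E}` for bounded
measurable `H`, `Nf` with `Nf(U[(x,i) ↦ v]) = Nf(U)` (`i ≠ j`, `L ≥ 2`). [ours] -/
theorem integral_comp_plaquetteHolonomy_mul [SecondCountableTopology G]
    (hL : 2 ≤ L) (x : Site d L) {i j : Fin d} (hij : i ≠ j) {H : G → ℝ} (hHm : Measurable H) {C : ℝ}
    (hHb : ∀ g, |H g| ≤ C) {Nf : GaugeConfig d L G → ℝ} (hNm : Measurable Nf) {C' : ℝ}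
    (hNb : ∀ U, |Nf U| ≤ C') (hN : ∀ U v, Nf (update U (x, i) v) = Nf U) :
    ∫ U, H (plaquetteHolonomy U x i j) * Nf U ∂Measure.pi (fun _ : Edge d L => haarProbability G) =
      (∫ g, H g ∂(haarProbability G)) * ∫ U, Nf U ∂Measure.pi (fun _ : Edge d L => haarProbability G) := by
  set μ := haarProbability G with hμ
  have huniv : (fun _ : Edge d L => μ) (x, i) Set.univ ≠ 0 := by simp [hμ]
  have hFm : Measurable fun U : GaugeConfig d L G => H (plaquetteHolonomy U x i j) * Nf U :=
    (hHm.comp (measurable_plaquetteHolonomy x i j)).mul hNm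
  have hC : 0 ≤ C := (abs_nonneg _).trans (hHb 1)
  have hFi : Integrable (fun U : GaugeConfig d L G => H (plaquetteHolonomy U x i j) * Nf U)
      (Measure.pi fun _ : Edge d L => μ) :=
    Integrable.mono' (integrable_const (C * C')) hFm.aestronglyMeasurable
      (ae_of_all _ fun U => by
        rw [Real.norm_eq_abs, abs_mul]
        exact mul_le_mul (hHb _) (hNb _) (abs_nonneg _) hC)
  rw [integral_pi_eq_integral_integral_update' (fun _ : Edge d L => μ) (x, i) huniv hFi]
  simp only [measure_univ, inv_one, ENNReal.toReal_one, one_smul]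
  have hinner : ∀ U : GaugeConfig d L G,
      ∫ v, H (plaquetteHolonomy (update U (x, i) v) x i j) * Nf (update U (x, i) v) ∂μ =
        (∫ g, H g ∂μ) * Nf U := by
    intro U
    simp only [plaquetteHolonomy_update_first hL U x hij, hN]
    rw [integral_mul_const]
    congr 1
    exact integral_mul_right_eq_self H _
  simp_rw [hinner]
  rw [integral_const_mul]

omit [NeZero L] in
/-- `e_k + e_l ≠ 0` for `k ≠ l` on `(ℤ/L)^d`, `L ≥ 2` (the `k`-component is `1`). [ours] -/
theorem single_add_single_ne_zero_of_ne (hL : 2 ≤ L) {k l : Fin d} (hkl : k ≠ l) :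
    (Pi.single k (1 : ZMod L) : Site d L) + Pi.single l 1 ≠ 0 := by
  haveI : Fact (1 < L) := ⟨hL⟩
  intro h
  have := congrFun h k
  simp [Pi.single_eq_of_ne hkl] at this

/-! ## §2 The engine: the plaquette marginal reads the closing link -/

/-- **THE PLAQUETTE MARGINAL READS THE CLOSING LINK** (any compact `G`, continuous `ρ` with a
central element acting by a scalar `ω ≠ 1`, `|ω| = 1`; any `d`, `L ≥ 2`, `β > 0`): with `s` the links
off the plaquette `p`, the partial Haar marginal `N = A_s e^{−βS_W}` is not blind to the first link of
`p`.  Otherwise the plaquette holonomy would be Haar distributed under the Wilson weight and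
`∫ Re tr ρ(U_p) e^{−βS_W} = 0`, against the positive plaquette mean (tree). [ours] -/
theorem wilson_plaquetteMarginal_reads_closingLink [NeZero N] (hρ : Continuous ρ) (hL : 2 ≤ L)
    {z : G} {ω : ℂ} (hω : ρ z = ω • (1 : Matrix (Fin N) (Fin N) ℂ)) (hω1 : ‖ω‖ = 1) (hne : ω ≠ 1)
    {β : ℝ} (hβ : 0 < β) (p : Plaquette d L) :
    ∃ (U : GaugeConfig d L G) (v : G),
      coordAvg (haarProbability G)
          (Finset.univ \ {(p.1, p.2.1.1), (p.1.shift p.2.1.1, p.2.1.2), (p.1.shift p.2.1.2, p.2.1.1), (p.1, p.2.1.2)})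
          (fun V : GaugeConfig d L G => Real.exp (-β * wilsonAction ρ V)) (update U (p.1, p.2.1.1) v) ≠
      coordAvg (haarProbability G)
          (Finset.univ \ {(p.1, p.2.1.1), (p.1.shift p.2.1.1, p.2.1.2), (p.1.shift p.2.1.2, p.2.1.1), (p.1, p.2.1.2)})
          (fun V : GaugeConfig d L G => Real.exp (-β * wilsonAction ρ V)) U := by
  classical
  set μ := haarProbability G with hμ
  set x := p.1 with hx
  set k := p.2.1.1 with hk
  set l := p.2.1.2 with hl
  have hkl : k ≠ l := ne_of_lt p.2.2
  set s : Finset (Edge d L) := Finset.univ \ {(x, k), (x.shift k, l), (x.shift l, k), (x, l)} with hs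
  set F : GaugeConfig d L G → ℝ := fun V => Real.exp (-β * wilsonAction ρ V) with hF
  set Nf := coordAvg μ s F with hN'
  by_contra hcon
  push Not at hcon
  obtain ⟨hFm, B, hFlo, hFhi⟩ := wilsonWeight_props (d := d) (L := L) ρ hρ β
  have hNb : ∀ U, Real.exp (-(|β| * B)) ≤ Nf U ∧ Nf U ≤ Real.exp (|β| * B) := fun U =>
    coordAvg_mem_Icc μ s hFm hFlo hFhi U
  have hNpos : ∀ U, 0 < Nf U := fun U => lt_of_lt_of_le (Real.exp_pos _) (hNb U).1
  have hNabs : ∀ U, |Nf U| ≤ Real.exp (|β| * B) := fun U => by rw [abs_of_pos (hNpos U)]; exact (hNb U).2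
  have hFb : ∀ U, |F U| ≤ Real.exp (|β| * B) := fun U => by
    simp only [hF]; rw [abs_of_pos (Real.exp_pos _)]; exact hFhi U
  haveI : Fact (1 < L) := ⟨hL⟩
  -- the positive plaquette mean (tree), in integral form
  have hZ : 0 < ∫ U, Real.exp (-β * wilsonAction ρ U) ∂Measure.pi (fun _ : Edge d L => μ) :=
    integral_exp_pos (Literature.Probability.LatticeModels.integrable_of_continuous_compactSpace _
      (Real.continuous_exp.comp (continuous_const.mul (continuous_wilsonAction ρ hρ))))
  have hpos : 0 < ∫ U, (ρ (plaquetteHolonomy U x k l)).trace.re * F U ∂Measure.pi (fun _ : Edge d L => μ) := by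
    have h := wilsonExpectation_re_trace_plaquette_pos (d := d) (L := L) ρ hρ hω hω1 hne hβ x hkl
    rw [wilsonExpectation_eq_integral_div ρ hρ] at h
    exact (div_pos_iff.1 h).elim (fun h' => h'.1) fun h' => absurd h'.2 (not_lt.2 hZ.le)
  -- the Haar mean of the plaquette character vanishes (tree), hence so does that of `Re tr ρ`
  have h0 : ∫ g, (ρ g).trace.re ∂(haarProbability G) = 0 := by
    obtain ⟨Mρ, -, hMρ⟩ := exists_bound_trace_re_nonneg ρ hρ
    have hrm : Measurable fun g : G => (ρ g).trace.re := (Complex.continuous_re.comp hρ.matrix_trace).measurable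
    rw [← integral_comp_plaquetteHolonomy hL x hkl hrm hMρ]
    exact integral_re_trace_plaquetteHolonomy_eq_zero ρ hρ hω hne x hkl
  -- `∫ X·F = ∫ X·N` (conditional expectation; `X = Re tr ρ ∘ hol_p` is blind to `s`)
  obtain ⟨Mρ, -, hMρ⟩ := exists_bound_trace_re_nonneg ρ hρ
  have hrm : Measurable fun g : G => (ρ g).trace.re := (Complex.continuous_re.comp hρ.matrix_trace).measurable
  have hn1 : ((x, k) : Edge d L) ∉ s := by simp [hs]
  have hn2 : ((x.shift k, l) : Edge d L) ∉ s := by simp [hs]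
  have hn3 : ((x.shift l, k) : Edge d L) ∉ s := by simp [hs]
  have hn4 : ((x, l) : Edge d L) ∉ s := by simp [hs]
  have hhol_s : ∀ U V : GaugeConfig d L G,
      plaquetteHolonomy (s.piecewise V U) x k l = plaquetteHolonomy U x k l := by
    intro U V
    simp only [plaquetteHolonomy, Finset.piecewise_eq_of_notMem _ _ _ hn1,
      Finset.piecewise_eq_of_notMem _ _ _ hn2, Finset.piecewise_eq_of_notMem _ _ _ hn3,
      Finset.piecewise_eq_of_notMem _ _ _ hn4]
  have hXm : Measurable fun U : GaugeConfig d L G => (ρ (plaquetteHolonomy U x k l)).trace.re :=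
    hrm.comp (measurable_plaquetteHolonomy x k l)
  have h1 : ∫ U, (ρ (plaquetteHolonomy U x k l)).trace.re * F U ∂Measure.pi (fun _ : Edge d L => μ) =
      ∫ U, (ρ (plaquetteHolonomy U x k l)).trace.re * Nf U ∂Measure.pi (fun _ : Edge d L => μ) :=
    integral_mul_coordAvg_eq μ s (Φ := fun U => (ρ (plaquetteHolonomy U x k l)).trace.re) hFm ⟨_, hFb⟩
      hXm ⟨Mρ, fun U => hMρ _⟩ (fun U V => by simp only [hhol_s])
  -- redraw `e₁`: `∫ X·N = (∫ Re tr ρ dHaar)·(∫ N) = 0`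
  have h2 : ∫ U, (ρ (plaquetteHolonomy U x k l)).trace.re * Nf U ∂Measure.pi (fun _ : Edge d L => μ) = 0 := by
    rw [hμ, integral_comp_plaquetteHolonomy_mul hL x hkl hrm hMρ (measurable_coordAvg _ s hFm) hNabs hcon,
      h0, zero_mul]
  exact (ne_of_gt hpos) (h1.trans h2)

/-! ## §3 Quantitative form: the marginal deviates from its `e₁`-average by at least the plaquette mean -/

/-- **QUANTITATIVE ENGINE — a total-variation lower bound.**  With `N = A_s F`, `M = A_{insert e₁ s} F`
(the `e₁`-average of `N`): `∫ Re tr ρ(U_p)·e^{−βS_W} dHaar^{⊗E} ≤ N_dim · ∫ |N − M| dHaar^{⊗E}`.  Dividing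
by `Z = ∫ e^{−βS_W}`: `∫ |N − M|/Z` is twice the Wilson-measure average of the total-variation distance
between the exact conditional law of `U_{e₁}` given the staple (everything else integrated) and the Haar
prior, so that average is at least `⟨(1/N) Re tr ρ(U_p)⟩_β / 2 = ⟨W_{1×1}⟩_β / 2 > 0` — by the tree's
volume-uniform weak-coupling floor it tends to `1/2` as `β → ∞`, uniformly in `L`. [ours] -/
theorem wilson_plaquetteMarginal_tv_lower_bound (hρ : Continuous ρ) (hL : 2 ≤ L)
    {z : G} {ω : ℂ} (hω : ρ z = ω • (1 : Matrix (Fin N) (Fin N) ℂ)) (hne : ω ≠ 1)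
    (β : ℝ) (p : Plaquette d L) :
    ∫ U, (ρ (plaquetteHolonomy U p.1 p.2.1.1 p.2.1.2)).trace.re * Real.exp (-β * wilsonAction ρ U)
        ∂Measure.pi (fun _ : Edge d L => haarProbability G) ≤
      (N : ℝ) * ∫ U, |coordAvg (haarProbability G)
            (Finset.univ \ {(p.1, p.2.1.1), (p.1.shift p.2.1.1, p.2.1.2), (p.1.shift p.2.1.2, p.2.1.1), (p.1, p.2.1.2)})
            (fun V : GaugeConfig d L G => Real.exp (-β * wilsonAction ρ V)) U -
          coordAvg (haarProbability G)
            (insert (p.1, p.2.1.1)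
              (Finset.univ \ {(p.1, p.2.1.1), (p.1.shift p.2.1.1, p.2.1.2), (p.1.shift p.2.1.2, p.2.1.1), (p.1, p.2.1.2)}))
            (fun V : GaugeConfig d L G => Real.exp (-β * wilsonAction ρ V)) U|
        ∂Measure.pi (fun _ : Edge d L => haarProbability G) := by
  classical
  haveI : Fact (1 < L) := ⟨hL⟩
  set μ := haarProbability G with hμ
  set x := p.1 with hx
  set k := p.2.1.1 with hk
  set l := p.2.1.2 with hl
  have hkl : k ≠ l := ne_of_lt p.2.2
  set s : Finset (Edge d L) := Finset.univ \ {(x, k), (x.shift k, l), (x.shift l, k), (x, l)} with hs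
  set F : GaugeConfig d L G → ℝ := fun V => Real.exp (-β * wilsonAction ρ V) with hF
  set Nf := coordAvg μ s F with hN'
  set M := coordAvg μ (insert (x, k) s) F with hM
  obtain ⟨hFm, B, hFlo, hFhi⟩ := wilsonWeight_props (d := d) (L := L) ρ hρ β
  have hFb : ∀ U, |F U| ≤ Real.exp (|β| * B) := fun U => by
    simp only [hF]; rw [abs_of_pos (Real.exp_pos _)]; exact hFhi U
  have hNb : ∀ U, Real.exp (-(|β| * B)) ≤ Nf U ∧ Nf U ≤ Real.exp (|β| * B) := fun U =>
    coordAvg_mem_Icc μ s hFm hFlo hFhi U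
  have hMb : ∀ U, Real.exp (-(|β| * B)) ≤ M U ∧ M U ≤ Real.exp (|β| * B) := fun U =>
    coordAvg_mem_Icc μ (insert (x, k) s) hFm hFlo hFhi U
  have hNabs : ∀ U, |Nf U| ≤ Real.exp (|β| * B) := fun U => by
    rw [abs_of_pos (lt_of_lt_of_le (Real.exp_pos _) (hNb U).1)]; exact (hNb U).2
  have hMabs : ∀ U, |M U| ≤ Real.exp (|β| * B) := fun U => by
    rw [abs_of_pos (lt_of_lt_of_le (Real.exp_pos _) (hMb U).1)]; exact (hMb U).2
  have hNm : Measurable Nf := measurable_coordAvg _ s hFm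
  have hMm : Measurable M := measurable_coordAvg _ (insert (x, k) s) hFm
  have hMe₁ : ∀ (U : GaugeConfig d L G) (v : G), M (update U (x, k) v) = M U := by
    intro U v
    refine coordAvg_congr_off (insert (x, k) s) F fun e he => ?_
    have : e ≠ (x, k) := fun h => he (h ▸ Finset.mem_insert_self (x, k) s)
    exact update_of_ne this _ _
  -- the observable `X = Re tr ρ ∘ hol_p`: bounded by `N`, measurable, blind to `s`
  have hrm : Measurable fun g : G => (ρ g).trace.re := (Complex.continuous_re.comp hρ.matrix_trace).measurable
  have hXb : ∀ g : G, |(ρ g).trace.re| ≤ (N : ℝ) := fun g => by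
    simpa using Literature.RepresentationTheory.CompactGroups.CompactGroup.abs_re_trace_le_card ρ hρ g
  have hXm : Measurable fun U : GaugeConfig d L G => (ρ (plaquetteHolonomy U x k l)).trace.re :=
    hrm.comp (measurable_plaquetteHolonomy x k l)
  have hn1 : ((x, k) : Edge d L) ∉ s := by simp [hs]
  have hn2 : ((x.shift k, l) : Edge d L) ∉ s := by simp [hs]
  have hn3 : ((x.shift l, k) : Edge d L) ∉ s := by simp [hs]
  have hn4 : ((x, l) : Edge d L) ∉ s := by simp [hs]
  have hhol_s : ∀ U V : GaugeConfig d L G,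
      plaquetteHolonomy (s.piecewise V U) x k l = plaquetteHolonomy U x k l := by
    intro U V
    simp only [plaquetteHolonomy, Finset.piecewise_eq_of_notMem _ _ _ hn1,
      Finset.piecewise_eq_of_notMem _ _ _ hn2, Finset.piecewise_eq_of_notMem _ _ _ hn3,
      Finset.piecewise_eq_of_notMem _ _ _ hn4]
  -- Step 1: `∫ X F = ∫ X N`
  have h1 : ∫ U, (ρ (plaquetteHolonomy U x k l)).trace.re * F U ∂Measure.pi (fun _ : Edge d L => μ) =
      ∫ U, (ρ (plaquetteHolonomy U x k l)).trace.re * Nf U ∂Measure.pi (fun _ : Edge d L => μ) :=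
    integral_mul_coordAvg_eq μ s (Φ := fun U => (ρ (plaquetteHolonomy U x k l)).trace.re) hFm ⟨_, hFb⟩
      hXm ⟨N, fun U => hXb _⟩ (fun U V => by simp only [hhol_s])
  -- Step 2: `∫ X M = (∫ Re tr ρ dHaar)·∫ M = 0`
  have h0 : ∫ g, (ρ g).trace.re ∂(haarProbability G) = 0 := by
    rw [← integral_comp_plaquetteHolonomy hL x hkl hrm hXb]
    exact integral_re_trace_plaquetteHolonomy_eq_zero ρ hρ hω hne x hkl
  have h2 : ∫ U, (ρ (plaquetteHolonomy U x k l)).trace.re * M U ∂Measure.pi (fun _ : Edge d L => μ) = 0 := by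
    rw [hμ, integral_comp_plaquetteHolonomy_mul hL x hkl hrm hXb hMm hMabs hMe₁, h0, zero_mul]
  -- Step 3: `∫ X N = ∫ X (N − M) ≤ N_dim ∫ |N − M|`
  have hiXN : Integrable (fun U : GaugeConfig d L G => (ρ (plaquetteHolonomy U x k l)).trace.re * Nf U)
      (Measure.pi fun _ : Edge d L => μ) :=
    Integrable.mono' (integrable_const ((N : ℝ) * Real.exp (|β| * B))) ((hXm.mul hNm).aestronglyMeasurable)
      (ae_of_all _ fun U => by
        rw [Real.norm_eq_abs, abs_mul]
        exact mul_le_mul (hXb _) (hNabs U) (abs_nonneg _) (Nat.cast_nonneg N))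
  have hiXM : Integrable (fun U : GaugeConfig d L G => (ρ (plaquetteHolonomy U x k l)).trace.re * M U)
      (Measure.pi fun _ : Edge d L => μ) :=
    Integrable.mono' (integrable_const ((N : ℝ) * Real.exp (|β| * B))) ((hXm.mul hMm).aestronglyMeasurable)
      (ae_of_all _ fun U => by
        rw [Real.norm_eq_abs, abs_mul]
        exact mul_le_mul (hXb _) (hMabs U) (abs_nonneg _) (Nat.cast_nonneg N))
  have hiabs : Integrable (fun U : GaugeConfig d L G => |Nf U - M U|) (Measure.pi fun _ : Edge d L => μ) :=
    (Integrable.mono' (integrable_const _) hNm.aestronglyMeasurable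
        (ae_of_all _ fun U => by rw [Real.norm_eq_abs]; exact hNabs U)).sub
      (Integrable.mono' (integrable_const _) hMm.aestronglyMeasurable
        (ae_of_all _ fun U => by rw [Real.norm_eq_abs]; exact hMabs U)) |>.abs
  have h3 : ∫ U, (ρ (plaquetteHolonomy U x k l)).trace.re * Nf U ∂Measure.pi (fun _ : Edge d L => μ) =
      ∫ U, (ρ (plaquetteHolonomy U x k l)).trace.re * (Nf U - M U) ∂Measure.pi (fun _ : Edge d L => μ) := by
    have : ∀ U : GaugeConfig d L G, (ρ (plaquetteHolonomy U x k l)).trace.re * (Nf U - M U) =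
        (ρ (plaquetteHolonomy U x k l)).trace.re * Nf U - (ρ (plaquetteHolonomy U x k l)).trace.re * M U :=
      fun U => by ring
    simp_rw [this]
    rw [integral_sub hiXN hiXM, h2, sub_zero]
  rw [h1, h3, ← integral_const_mul]
  have hiL : Integrable (fun U : GaugeConfig d L G =>
      (ρ (plaquetteHolonomy U x k l)).trace.re * (Nf U - M U)) (Measure.pi fun _ : Edge d L => μ) :=
    (hiXN.sub hiXM).congr (ae_of_all _ fun U => by simp only [Pi.sub_apply]; ring)
  exact integral_mono hiL (hiabs.const_mul _) fun U =>
    (le_abs_self _).trans (by rw [abs_mul]; exact mul_le_mul_of_nonneg_right (hXb _) (abs_nonneg _))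

/-- `u1Rep (−1) = (−1)·1`: the central element `−1 ∈ U(1)` acts by the scalar `−1 ≠ 1`. [ours] -/
theorem u1Rep_neg_one : u1Rep (-1) = (-1 : ℂ) • (1 : Matrix (Fin 1) (Fin 1) ℂ) := by
  ext i j
  fin_cases i; fin_cases j
  simp [u1Rep_apply]

/-- **The `U(1)` instance of the engine**: in every dimension, `L ≥ 2`, `β > 0`, the partial Haar
marginal over the links off a plaquette reads the closing link. [ours] -/
theorem wilson_u1_plaquetteMarginal_reads_closingLink' {d L : ℕ} [NeZero L] (hL : 2 ≤ L) {β : ℝ}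
    (hβ : 0 < β) (p : Plaquette d L) :
    ∃ (U : GaugeConfig d L Circle) (v : Circle),
      coordAvg (haarProbability Circle)
          (Finset.univ \ {(p.1, p.2.1.1), (p.1.shift p.2.1.1, p.2.1.2), (p.1.shift p.2.1.2, p.2.1.1), (p.1, p.2.1.2)})
          (fun V : GaugeConfig d L Circle => Real.exp (-β * wilsonAction u1Rep V)) (update U (p.1, p.2.1.1) v) ≠
      coordAvg (haarProbability Circle)
          (Finset.univ \ {(p.1, p.2.1.1), (p.1.shift p.2.1.1, p.2.1.2), (p.1.shift p.2.1.2, p.2.1.1), (p.1, p.2.1.2)})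
          (fun V : GaugeConfig d L Circle => Real.exp (-β * wilsonAction u1Rep V)) U :=
  wilson_plaquetteMarginal_reads_closingLink u1Rep continuous_u1Rep hL u1Rep_neg_one (by simp)
    (by norm_num) hβ p

end Summit.Ventures.LatticeQCDFlow.Theory2.Autoregressive

end
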